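import Mathlib
import HarnessLib
import Summits.Ventures.LatticeQCDFlow.Scaling.AutoregressiveGaugeHeatBathClosingMapFloor
import Summits.Ventures.LatticeQCDFlow.Scaling.AutoregressiveGaugeHeatBathVolumeLaw

/-!
# LatticeQCDFlow / Scaling — the cold start freezes, with every uncovered plaquette paying: the exact sampler
# started at the cold configuration is still there after `t` steps with probability `≥ (1 − η)^t`,
# `η = ∏_{a∈B} c_{n_a+1}/(c·M^{n_a})` for a total closing map

HONEST FRAMING: exact (Metropolis-corrected) sampling algorithms for lattice gauge theory;
figures of merit are autocorrelation/cost numbers at stated couplings and volumes; no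
continuum-physics claim.

Venture `LatticeQCDFlow` (cell pub-lqcd), topic `Scaling`, FANOUT row 30 (lean-1, GEN-27) — OUR WORK on
THEORY-2.md §4 row C5.  GEN-26's `AutoregressiveGaugeHeatBathVolumeLaw.closing_coldStart_frozen` with the
closing SECTION's `(M₂/M)^s` replaced by the total closing MAP's `η = ∏_{a∈B} θ_a`
(`AutoregressiveGaugeHeatBathClosingMapFloor`): **`totalClosingMap_coldStart_frozen`** — `L ≥ 2`; `w`
continuous, `0 < m ≤ w ≤ M = w(1)`; `(B, t, rank)` ranked with a total closing map `u : Bᶜ → B`; then the exact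
sampler (independence Metropolis, block proposal `q_B`, target `π`) started at the Dirac mass of the cold
configuration `U ≡ 1` satisfies `(K^t δ_cold)({cold}) ≥ (1 − η)^t` for every `t` (row 2's holding bound
`indepMH_iterate_dirac_singleton_real_ge_pow` with the acceptance bound of the closing-map floor; `η ≤ 1` by
`ratio_le_one`).  For an optimal structure take the total closing map of
`AutoregressiveGaugeHeatBathClosingMapFloor.exists_closingMap_of_optimal`.

No `def`, no `sorry`, nothing cited as a fact beyond the tree.
-/

noncomputable section

namespace Summit.Ventures.LatticeQCDFlow.Theory2.Autoregressive

open MeasureTheory ProbabilityTheory Function Finset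
open Summit.Ventures.LatticeQCDFlow.Exactness Summit.Ventures.LatticeQCDFlow.Scoring
open Literature.MathematicalPhysics.QuantumFieldTheory Literature.MathematicalPhysics.QuantumLattice
open scoped ENNReal

variable {d L : ℕ} [NeZero L] {G : Type*} [Group G] [TopologicalSpace G] [IsTopologicalGroup G]
  [CompactSpace G] [SecondCountableTopology G] [MeasurableSpace G] [BorelSpace G]

/-- **THE COLD START FREEZES (total closing map).**  See the module docstring. [ours] -/
theorem totalClosingMap_coldStart_frozen [MeasurableSingletonClass G] (hL : 2 ≤ L) {w : G → ℝ}
    (hw : Continuous w) {m M : ℝ} (hm0 : 0 < m) (hm : ∀ g, m ≤ w g) (hM : ∀ g, w g ≤ M) (hw1 : w 1 = M)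
    (B : Finset (Plaquette d L)) (t : Plaquette d L → Edge d L)
    (ht : ∀ p ∈ B, t p ∈ ({(p.1, p.2.1.1), (p.1.shift p.2.1.1, p.2.1.2),
        (p.1.shift p.2.1.2, p.2.1.1), (p.1, p.2.1.2)} : Finset (Edge d L)))
    (rank : Plaquette d L → ℕ)
    (hrank : ∀ p ∈ B, ∀ p' ∈ B, p ≠ p' → t p ∈ ({(p'.1, p'.2.1.1), (p'.1.shift p'.2.1.1, p'.2.1.2),
        (p'.1.shift p'.2.1.2, p'.2.1.1), (p'.1, p'.2.1.2)} : Finset (Edge d L)) → rank p < rank p')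
    (u : Plaquette d L → Plaquette d L)
    (huB : ∀ p' ∈ Finset.univ \ B, u p' ∈ B)
    (hut : ∀ p' ∈ Finset.univ \ B, t (u p') ∈ ({(p'.1, p'.2.1.1), (p'.1.shift p'.2.1.1, p'.2.1.2),
        (p'.1.shift p'.2.1.2, p'.2.1.1), (p'.1, p'.2.1.2)} : Finset (Edge d L)))
    (humax : ∀ p' ∈ Finset.univ \ B, ∀ p ∈ B, p ≠ u p' → t p ∈ ({(p'.1, p'.2.1.1), (p'.1.shift p'.2.1.1, p'.2.1.2),
        (p'.1.shift p'.2.1.2, p'.2.1.1), (p'.1, p'.2.1.2)} : Finset (Edge d L)) → rank p < rank (u p'))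
    (π q : Measure (GaugeConfig d L G)) [IsProbabilityMeasure π] [IsProbabilityMeasure q]
    (hπ : π = (Measure.pi fun _ : Edge d L => haarProbability G).withDensity fun U =>
      ENNReal.ofReal ((∏ p : Plaquette d L, w (plaquetteHolonomy U p.1 p.2.1.1 p.2.1.2)) /
        ∫ V, ∏ p : Plaquette d L, w (plaquetteHolonomy V p.1 p.2.1.1 p.2.1.2)
          ∂(Measure.pi fun _ : Edge d L => haarProbability G)))
    (hq : q = (Measure.pi fun _ : Edge d L => haarProbability G).withDensity fun U =>
      ENNReal.ofReal ((∏ p ∈ B, w (plaquetteHolonomy U p.1 p.2.1.1 p.2.1.2)) /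
        ∫ V, ∏ p ∈ B, w (plaquetteHolonomy V p.1 p.2.1.1 p.2.1.2)
          ∂(Measure.pi fun _ : Edge d L => haarProbability G))) (n : ℕ) :
    (1 - (∏ a ∈ B, (∫ h, w h ^ (((Finset.univ \ B).filter (fun p' => u p' = a)).card + 1) ∂(haarProbability G)) /
          ((∫ g, w g ∂(haarProbability G)) * M ^ ((Finset.univ \ B).filter (fun p' => u p' = a)).card))) ^ n ≤
      ((fun ν : Measure (GaugeConfig d L G) => ν.bind (indepMH q fun U =>
        ((∫ V, ∏ p : Plaquette d L, w (plaquetteHolonomy V p.1 p.2.1.1 p.2.1.2)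
            ∂(Measure.pi fun _ : Edge d L => haarProbability G)) /
          ((∫ V, ∏ p ∈ B, w (plaquetteHolonomy V p.1 p.2.1.1 p.2.1.2)
            ∂(Measure.pi fun _ : Edge d L => haarProbability G)) *
            ∏ p ∈ Finset.univ \ B, w (plaquetteHolonomy U p.1 p.2.1.1 p.2.1.2)))⁻¹))^[n]
        (Measure.dirac (fun _ : Edge d L => (1 : G)))).real {fun _ : Edge d L => (1 : G)} := by
  set Haar : Measure (GaugeConfig d L G) := Measure.pi fun _ : Edge d L => haarProbability G with hHaar
  set FT : GaugeConfig d L G → ℝ := fun U => ∏ p : Plaquette d L, w (plaquetteHolonomy U p.1 p.2.1.1 p.2.1.2)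
    with hFT
  set FB : GaugeConfig d L G → ℝ := fun U => ∏ p ∈ B, w (plaquetteHolonomy U p.1 p.2.1.1 p.2.1.2) with hFB
  set FR : GaugeConfig d L G → ℝ := fun U => ∏ p ∈ Finset.univ \ B, w (plaquetteHolonomy U p.1 p.2.1.1 p.2.1.2)
    with hFR
  set ZT : ℝ := ∫ V, FT V ∂Haar with hZT
  set ZB : ℝ := ∫ V, FB V ∂Haar with hZB
  set k : ℕ := (Finset.univ \ B).card with hk
  set η : ℝ := (∏ a ∈ B, (∫ h, w h ^ (((Finset.univ \ B).filter (fun p' => u p' = a)).card + 1) ∂(haarProbability G)) /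
          ((∫ g, w g ∂(haarProbability G)) * M ^ ((Finset.univ \ B).filter (fun p' => u p' = a)).card)) with hηdef
  set cold : GaugeConfig d L G := fun _ => (1 : G) with hcold
  have hw0 : ∀ g, 0 < w g := fun g => hm0.trans_le (hm g)
  have hMpos : 0 < M := (hw0 1).trans_le (hM 1)
  haveI : IsProbabilityMeasure Haar := by rw [hHaar]; infer_instance
  have hc : 0 < ∫ g, w g ∂(haarProbability G) := haarProbability_integral_pos_of_continuous_pos hw hw0
  have hFTc : Continuous FT := continuous_prodPlaquetteWeight_anyDim hw Finset.univ
  have hFRc : Continuous FR := continuous_prodPlaquetteWeight_anyDim hw (Finset.univ \ B)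
  have hFTpos : ∀ U, 0 < FT U := fun U => prod_pos fun p _ => hw0 _
  have hFBpos : ∀ U, 0 < FB U := fun U => prod_pos fun p _ => hw0 _
  have hFRpos : ∀ U, 0 < FR U := fun U => prod_pos fun p _ => hw0 _
  have hFRle : ∀ U, FR U ≤ M ^ k := fun U => (pow_le_prodPlaquetteWeight_le_pow_anyDim hm0 hm hM _ U).2
  have hsplit : ∀ U, FT U = FR U * FB U := fun U => (Finset.prod_sdiff (Finset.subset_univ B)).symm
  have hint : ∀ {F : GaugeConfig d L G → ℝ}, Continuous F → (∀ U, 0 < F U) → ∀ K : ℝ, (∀ U, F U ≤ K) →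
      Integrable F Haar := by
    intro F hF hF0 K hK
    refine Integrable.mono' (integrable_const K) hF.aestronglyMeasurable (ae_of_all _ fun U => ?_)
    rw [Real.norm_eq_abs, abs_of_pos (hF0 U)]; exact hK U
  have hFTi : Integrable FT Haar :=
    hint hFTc hFTpos (M ^ (Finset.univ : Finset (Plaquette d L)).card)
      fun U => (pow_le_prodPlaquetteWeight_le_pow_anyDim hm0 hm hM _ U).2
  have hFBc : Continuous FB := continuous_prodPlaquetteWeight_anyDim hw B
  have hFBi : Integrable FB Haar :=
    hint hFBc hFBpos (M ^ B.card) fun U => (pow_le_prodPlaquetteWeight_le_pow_anyDim hm0 hm hM _ U).2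
  have hZTpos : 0 < ZT := by
    have h := integral_mono (integrable_const (m ^ (Finset.univ : Finset (Plaquette d L)).card)) hFTi
      fun U => (pow_le_prodPlaquetteWeight_le_pow_anyDim hm0 hm hM _ U).1
    rw [integral_const, smul_eq_mul, probReal_univ, one_mul] at h
    exact lt_of_lt_of_le (pow_pos hm0 _) h
  have hZB' : ZB = (∫ g, w g ∂(haarProbability G)) ^ B.card :=
    integral_prod_weight_eq_pow_of_rank (G := G) hL hw hm0 hm hM B t ht rank hrank
  have hZBpos : 0 < ZB := by rw [hZB']; exact pow_pos hc _
  -- `Z ≤ Z_B M^k` (the scorecard squeeze): the cold configuration has `ρ ≤ 1`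
  have hZTle : ZT ≤ ZB * M ^ k := by
    calc ZT = ∫ V, FR V * FB V ∂Haar := by simp_rw [hZT, hsplit]
      _ ≤ ∫ V, M ^ k * FB V ∂Haar :=
          integral_mono_of_nonneg (ae_of_all _ fun V => (mul_pos (hFRpos V) (hFBpos V)).le)
            (hFBi.const_mul _) (ae_of_all _ fun V => mul_le_mul_of_nonneg_right (hFRle V) (hFBpos V).le)
      _ = ZB * M ^ k := by rw [integral_const_mul, hZB, mul_comm]
  -- the density ratio and the kernel weight
  set ρ : GaugeConfig d L G → ℝ := fun U => ZT / (ZB * FR U) with hρ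
  have hρpos : ∀ U, 0 < ρ U := fun U => div_pos hZTpos (mul_pos hZBpos (hFRpos U))
  have hρm : Measurable ρ := (continuous_const.div (continuous_const.mul hFRc)
    fun U => (mul_pos hZBpos (hFRpos U)).ne').measurable
  have hρq : q = π.withDensity fun U => ENNReal.ofReal (ρ U) := by
    rw [hq, hπ]
    change Haar.withDensity (fun U => ENNReal.ofReal (FB U / ZB)) =
      (Haar.withDensity fun U => ENNReal.ofReal (FT U / ZT)).withDensity fun U => ENNReal.ofReal (ρ U)
    rw [← withDensity_mul _ (by fun_prop : Measurable fun U => ENNReal.ofReal (FT U / ZT))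
      (by exact hρm.ennreal_ofReal)]
    refine withDensity_congr_ae (ae_of_all _ fun U => ?_)
    simp only [Pi.mul_apply]
    rw [← ENNReal.ofReal_mul (div_nonneg (hFTpos U).le hZTpos.le)]
    congr 1
    rw [hρ, hsplit U]
    field_simp [(hFRpos U).ne', hZBpos.ne', hZTpos.ne']
  have hπ' : (q.withDensity fun U => ENNReal.ofReal (ρ U)⁻¹) = π := withDensity_inv_density hρm hρpos hρq
  have hwm : Measurable fun U => (ρ U)⁻¹ := hρm.inv
  have hw0' : ∀ U, 0 < (ρ U)⁻¹ := fun U => inv_pos.2 (hρpos U)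
  have hone : ∫⁻ y, ENNReal.ofReal (ρ y)⁻¹ ∂q = ENNReal.ofReal 1 := by
    have h : π Set.univ = 1 := measure_univ
    rw [← hπ', withDensity_apply _ MeasurableSet.univ, Measure.restrict_univ] at h
    rw [h, ENNReal.ofReal_one]
  -- at the cold configuration: `F_R = M^k`, `ρ ≤ η` and `ρ ≤ 1`
  have hFRcold : FR cold = M ^ k := by rw [hFR, hcold]; simp only []; rw [prod_plaquetteWeight_cold, hw1]
  have hρcold : ρ cold ≤ η := by
    have h1 : ρ cold ≤ η * (M ^ k / FR cold) := by
      have hdiv : ZT / ZB ≤ η * M ^ k :=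
        integral_prod_weight_div_le_of_totalClosingMap (G := G) hL hw hm0 hm hM B t ht rank hrank u huB hut
          humax
      calc ρ cold = (ZT / ZB) / FR cold := by rw [hρ, div_div]
        _ ≤ (η * M ^ k) / FR cold := div_le_div_of_nonneg_right hdiv (hFRpos cold).le
        _ = η * (M ^ k / FR cold) := mul_div_assoc _ _ _
    rwa [hFRcold, div_self (pow_ne_zero _ hMpos.ne'), mul_one] at h1
  have hρcold1 : (1 : ℝ) ≤ (ρ cold)⁻¹ := by
    rw [one_le_inv₀ (hρpos cold), hρ]
    show ZT / (ZB * FR cold) ≤ 1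
    rw [hFRcold, div_le_one (mul_pos hZBpos (pow_pos hMpos _))]
    exact hZTle
  have hstick := indepMH_iterate_dirac_singleton_real_ge_pow (q := q) hwm hw0' zero_le_one hone cold
    hρcold1 n
  rw [one_div, inv_inv] at hstick
  have hη1 : η ≤ 1 := by
    rw [hηdef]
    exact Finset.prod_le_one (fun a _ => div_nonneg (integral_nonneg fun h => pow_nonneg (hw0 h).le _)
      (mul_nonneg hc.le (pow_nonneg hMpos.le _))) fun a _ => ratio_le_one hw hw0 hM _
  have hbase : 1 - η ≤ 1 - ρ cold := by linarith
  have hbase0 : 0 ≤ 1 - η := by linarith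
  exact (pow_le_pow_left₀ hbase0 hbase n).trans hstick

end Summit.Ventures.LatticeQCDFlow.Theory2.Autoregressive

end
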